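import Literature.MathematicalPhysics.QuantumLattice.WightmanPermutedTubeDim4Proofs
import Literature.MathematicalPhysics.QuantumLattice.WightmanAnalyticContinuationProofs
import Literature.MathematicalPhysics.QuantumLattice.WightmanPermutedTubeHolds
import HarnessLib

/-!
# The symmetric continuation to the permuted extended tube: the closed instances `d = 3`, `d = 0`

Topic `Literature/MathematicalPhysics/QuantumLattice` (trunk T-AQFT), sibling proof file of
`SchwingerWightmanSymmetry.lean`, for its named fact `IsWightmanQFT.exists_symmetric_continuation`
(Streater–Wightman Thms. 3-5, 3-6 with the Bargmann–Hall–Wightman Thm. 2-11; Osterwalder–Schrader I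
§5 p. 97 citing Jost (1965) p. 83: the `n`-point Wightman distribution of one scalar field is the
boundary value of a function analytic and permutation symmetric on the permuted extended tube
`𝒟ₙ`). The fact is recorded for every space dimension `d`; the printed sources are four-dimensional.
By `WightmanPermutedTube` it is (A) `IsWightmanQFT.exists_invariant_continuation` plus the
single-valuedness (K) `IsWightmanQFT.extendedTube_continuation_perm_eq`; (A) is now a theorem in
every dimension (`IsWightmanQFT.exists_invariant_continuation_holds`), and (K) is a theorem for
`d = 3` (`IsWightmanQFT.extendedTube_continuation_perm_eq_dim4_holds`: Streater–Wightman
Thm. 3-2 (d) and Thm. 3-6 — `WightmanLocality`, `WightmanPermutedTubeLocal`,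
`WightmanPermutedTubeReach` — and Tomozawa's connectedness of `𝒯'ₙ ∩ σ𝒯'ₙ` via the normal forms of
`L₊(ℂ)`, `WightmanPermutedTubeConnected` … `WightmanPermutedTubeDim4Proofs`). This file closes the
instances of the fact that are thereby settled:

* `IsWightmanQFT.exists_symmetric_continuation_holds_dim4` — **the fact in four space-time
  dimensions (`d = 3`), the scope of all sources, holds outright**;
* `properComplexLorentzGroup_zero_eq_one`, `relExtendedTube_zero`, `permReachable_zero`,
  `IsWightmanQFT.extendedTube_continuation_perm_eq_holds_zero`,
  `IsWightmanQFT.exists_symmetric_continuation_holds_zero` — the degenerate instance `d = 0`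
  (`L₊(ℂ)` is trivial, `𝒯'ₙ = 𝒯ʳₙ`, and `𝒯ʳₙ ∩ σ𝒯ʳₙ = ∅` for `σ ≠ 1`, so (K) is vacuous).

Not covered: `d = 2` and `d ≥ 4` (they would follow from a generalization of Tomozawa's
connectedness theorem from `L₊(ℂ) ≅ SL(2,ℂ) × SL(2,ℂ)/ℤ₂` to `SO(1, d; ℂ)`, for which we know no
source), and `d = 1` (where `𝒯'₃ ∩ (0 1)𝒯'₃` is non-empty without real points, so the printed route
through Thm. 3-6 does not apply; no source). The consumer of the fact in the tree,
`IsWickRotationOf.schwinger_symmetric`, is meanwhile proved in every dimension by another route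
(`SchwingerSymmetryEuclid`, `SchwingerSymmetryTwoDim`).

## Addendum (2026-08-15): every dimension

`WightmanPermutedTubeHolds` proves (K) for every `d = m + 1 ≥ 1` by a dimension-independent
argument (one-sided Jost anchors, `WightmanPermutedTubeAnchor`, supplied by a trichotomy in `L₊(ℂ)`,
`PermutedTubeRealAnchors`, and the identity theorem on the convex slices
`{w ∈ 𝒯ʳₙ | M(w ∘ σ) ∈ 𝒯ʳₙ}`), which needs neither common real points of `𝒯'ₙ` and `σ𝒯'ₙ` nor the
connectedness of their intersection. With the case `d = 0` above this closes both named facts in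
their recorded generality:

* `IsWightmanQFT.extendedTube_continuation_perm_eq_holds` — **(K) in every `d`**;
* `IsWightmanQFT.exists_symmetric_continuation_holds` — **the symmetric continuation to the permuted
  extended tube in every `d`** (the discharge of `IsWightmanQFT.exists_symmetric_continuation`).

## Sources

* R. F. Streater, A. S. Wightman, *PCT, Spin and Statistics, and All That* (1964), Thms. 3-5, 3-6
  (pdf pp. 100–102 of the held 2000 printing), Thm. 3-2 (d) (pdf p. 96). [StreaterWightman1964]
* K. Osterwalder, R. Schrader, Comm. Math. Phys. 31 (1973), §5 p. 97. [OsterwalderSchraderCMP1973]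
* Y. Tomozawa, J. Math. Phys. 4 (1963) 1240–1252. [Tomozawa1963]
-/

noncomputable section

open Set Complex
open _root_.Topology

namespace Literature.MathematicalPhysics.QuantumLattice

variable {κ : Type*} {n : ℕ}

/-! ### Four space-time dimensions -/

/-- **The symmetric continuation of the Wightman functions of one scalar field to the permuted
extended tube holds in four space-time dimensions** (Streater–Wightman (1964), Thms. 3-5, 3-6 with
Thm. 2-11; Osterwalder–Schrader I §5 p. 97; Tomozawa (1963)): the instance `d = 3` of the named fact
`IsWightmanQFT.exists_symmetric_continuation`, from the discharged Bargmann–Hall–Wightman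
continuation (`IsWightmanQFT.exists_invariant_continuation_holds`) and the discharged
single-valuedness on the permuted extended tube
(`IsWightmanQFT.extendedTube_continuation_perm_eq_dim4_holds`).
[cite: StreaterWightman1964, Thm 3-5, Thm 3-6] -/
theorem IsWightmanQFT.exists_symmetric_continuation_holds_dim4 :
    IsWightmanQFT.exists_symmetric_continuation (d := 3) (κ := κ) :=
  IsWightmanQFT.exists_symmetric_continuation_dim4 IsWightmanQFT.exists_invariant_continuation_holds

/-! ### The degenerate case `d = 0` -/

/-- In `1 + 0` dimensions the proper complex Lorentz group is trivial: a `ℂ`-linear automorphism of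
`ℂ¹` is a scalar, and its determinant is that scalar. [folklore] -/
theorem properComplexLorentzGroup_zero_eq_one {Λ : (Fin (0 + 1) → ℂ) ≃ₗ[ℂ] (Fin (0 + 1) → ℂ)}
    (hΛ : Λ ∈ properComplexLorentzGroup 0) : Λ = 1 := by
  -- `Λ` is multiplication by `c = Λ e 0`
  set e : Fin (0 + 1) → ℂ := Pi.single 0 1 with he
  set c : ℂ := Λ e 0 with hc
  have hvec : ∀ v : Fin (0 + 1) → ℂ, v = v 0 • e := fun v => by
    funext i
    have hi : i = 0 := Fin.fin_one_eq_zero i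
    subst hi
    simp [he]
  have hΛe : Λ e = c • e := by
    conv_lhs => rw [hvec (Λ e)]
  have hact : ∀ v : Fin (0 + 1) → ℂ, Λ v = c • v := fun v => by
    conv_lhs => rw [hvec v, map_smul, hΛe, smul_smul, mul_comm, ← smul_smul, ← hvec v]
  -- its determinant is `c`
  have hlin : (Λ : (Fin (0 + 1) → ℂ) →ₗ[ℂ] (Fin (0 + 1) → ℂ)) = c • LinearMap.id := by
    apply LinearMap.ext
    intro v
    simpa using hact v
  have hdet : (LinearEquiv.det Λ : ℂˣ) = 1 := ((mem_properComplexLorentzGroup_iff Λ).1 hΛ).2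
  have hdet' : LinearMap.det (Λ : (Fin (0 + 1) → ℂ) →ₗ[ℂ] (Fin (0 + 1) → ℂ)) = 1 := by
    rw [← LinearEquiv.coe_det, hdet, Units.val_one]
  have hc1 : c = 1 := by
    rw [hlin, LinearMap.det_smul, LinearMap.det_id, mul_one, Module.finrank_fin_fun] at hdet'
    simpa using hdet'
  refine LinearEquiv.ext fun v => ?_
  rw [hact v, hc1, one_smul]
  rfl

/-- In `1 + 0` dimensions the extended tube is the relative tube itself. [folklore] -/
theorem relExtendedTube_zero : relExtendedTube 0 n = QuantumFieldTheory.relForwardTube 0 n := by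
  refine Subset.antisymm ?_ relForwardTube_subset_relExtendedTube
  rintro z ⟨Λ, hΛ, w, hw, rfl⟩
  rw [properComplexLorentzGroup_zero_eq_one hΛ]
  simpa using hw

/-- In `1 + 0` dimensions the times of a point of the relative tube have strictly increasing
imaginary parts. [folklore] -/
theorem strictMono_im_of_mem_relForwardTube_zero {z : Fin n → Fin (0 + 1) → ℂ}
    (hz : z ∈ QuantumFieldTheory.relForwardTube 0 n) : StrictMono fun k => (z k 0).im := by
  cases n with
  | zero => intro a; exact a.elim0
  | succ m =>
    rw [mem_relForwardTube_succ_iff] at hz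
    refine Fin.strictMono_iff_lt_succ.2 fun j => ?_
    have h := (hz j).1
    simp only [imPart_apply, Pi.sub_apply, Complex.sub_im] at h
    simpa using h

/-- **The reachability condition holds trivially in `1 + 0` dimensions**: for `σ ≠ 1` no point
`z ∈ 𝒯'ₙ = 𝒯ʳₙ` has `z ∘ σ ∈ 𝒯ʳₙ` (the imaginary parts of the times would be strictly increasing in
two different orders). [folklore] -/
theorem permReachable_zero (n : ℕ) : PermReachable 0 n := by
  intro σ hσ z hz hzσ
  exfalso
  rw [relExtendedTube_zero] at hz hzσ
  have h1 := strictMono_im_of_mem_relForwardTube_zero hz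
  have h2 := strictMono_im_of_mem_relForwardTube_zero hzσ
  refine hσ (Equiv.Perm.eq_one_of_forall_apply_lt fun i j hij => ?_)
  have hlt : i < j := Fin.lt_def.2 (by omega)
  exact h1.lt_iff_lt.1 (h2 hlt)

/-- **(K) holds in `1 + 0` dimensions** (vacuously: `WightmanPermutedTube`, docstring of the fact).
[cite: OsterwalderSchraderCMP1973, §5 p. 97] -/
theorem IsWightmanQFT.extendedTube_continuation_perm_eq_holds_zero :
    IsWightmanQFT.extendedTube_continuation_perm_eq (d := 0) (κ := κ) :=
  IsWightmanQFT.extendedTube_continuation_perm_eq_of_permReachable permReachable_zero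

/-- **The symmetric continuation holds in `1 + 0` dimensions** (the instance `d = 0` of
`IsWightmanQFT.exists_symmetric_continuation`). [cite: StreaterWightman1964, Thm 3-5, Thm 3-6] -/
theorem IsWightmanQFT.exists_symmetric_continuation_holds_zero :
    IsWightmanQFT.exists_symmetric_continuation (d := 0) (κ := κ) :=
  IsWightmanQFT.exists_symmetric_continuation_of_perm_eq
    IsWightmanQFT.exists_invariant_continuation_holds
    IsWightmanQFT.extendedTube_continuation_perm_eq_holds_zero

/-! ### Every dimension -/

/-- **(K) holds in every space dimension `d`**: the Bargmann–Hall–Wightman continuation of the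
`n`-point function of one hermitian scalar field is consistent under permutations on `𝒯'ₙ ∩ σ𝒯'ₙ`
(Osterwalder–Schrader I §5 p. 97, "analytic, single valued, symmetric", citing Jost (1965) p. 83;
Streater–Wightman Thm. 3-6) — `d = 0` above, `d = m + 1` in `WightmanPermutedTubeHolds`.
[cite: OsterwalderSchraderCMP1973, §5 p. 97] -/
theorem IsWightmanQFT.extendedTube_continuation_perm_eq_holds {d : ℕ} :
    IsWightmanQFT.extendedTube_continuation_perm_eq (d := d) (κ := κ) := by
  cases d with
  | zero => exact IsWightmanQFT.extendedTube_continuation_perm_eq_holds_zero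
  | succ m => exact IsWightmanQFT.extendedTube_continuation_perm_eq_holds_succ

/-- **The symmetric analytic continuation of the Wightman functions of one scalar field holds in
every space dimension `d`** (the named fact `IsWightmanQFT.exists_symmetric_continuation`:
Streater–Wightman Thm. 3-5 with the Bargmann–Hall–Wightman Thm. 2-11, and Thm. 3-6; OS I §5 p. 97):
from (A) `IsWightmanQFT.exists_invariant_continuation_holds` and (K)
`IsWightmanQFT.extendedTube_continuation_perm_eq_holds` by the gluing
`IsWightmanQFT.exists_symmetric_continuation_of_perm_eq`. [cite: StreaterWightman1964, Thm 3-5, Thm 3-6] -/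
theorem IsWightmanQFT.exists_symmetric_continuation_holds {d : ℕ} :
    IsWightmanQFT.exists_symmetric_continuation (d := d) (κ := κ) :=
  IsWightmanQFT.exists_symmetric_continuation_of_perm_eq
    IsWightmanQFT.exists_invariant_continuation_holds
    IsWightmanQFT.extendedTube_continuation_perm_eq_holds

end Literature.MathematicalPhysics.QuantumLattice
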